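import Literature.NumberTheory.DiophantineApproximation.PolylogTwoPointHermitePade
import HarnessLib

/-!
# Parity Hermite–Padé forms at rational points `y = a/b` — vocabulary

Topic `Literature/NumberTheory/DiophantineApproximation`. The rational-point version of the coefficients of
`PolylogTwoPointHermitePade.lean` (the two-point / parity programme for `1, Li_s(±x)`): for partial-fraction
data `c` of the parity kernel `K^{(w)}_n` (`ParityPade.kernelH`, expanded by `ParityPade.exists_pf_kernelH`) and
a rational point `y = a/b` (`1 ≤ a`, `2a ≤ b`), with `h = n/2` (natural division),

  `a^h · 2^w Λ^{(w)}_n(a/b) = ∑_{o<w} A_o Li_{o+1}(a/b) + ∑_{o<w} B_o Θ_{o+1}(a/b) + C`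

with `A_o = coefLiQ n w c b a o = ∑_{p ≤ n, p odd} c_{o,p} 2^{w−1−o} b^{p/2} a^{h − p/2}`,
`B_o = coefThQ n w c b a o = ∑_{p ≤ n, p even} c_{o,p} 2^w b^{p/2} a^{h − p/2}` and the constant
`C = constHQ n w c b a` (from `∑_u y^{u+1}/(2u+p+1)^s = y^{−p/2}(Li_s(y) − ∑_{k<p/2} y^{k+1}/(k+1)^s)` for odd `p`,
`= y^{−p/2}(Θ_s(y) − ∑_{k<p/2} y^{k+1}/(2k+1)^s)` for even `p`, and `a^h y^{−p/2} = b^{p/2} a^{h−p/2}`). At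
`a = 1` these are `coefLi`, `coefTh`, `constH` with `M = b`. Definitions only; the identity, the integrality
(`d_n^w`), the sizes and the independence of `1, Li_s(a/b), Θ_s(a/b)` for `log b ≥ 8(w+1)³ + 4w log a` — hence of
`1, Li_s(M/N), Li_s(−M/N)` for `log N ≥ 4(w+1)³ + 4w log M` — are proved in the sibling files
`PolylogTwoPointHermitePadeRational*.lean` / `PolylogTwoPoint*LinearIndependenceRational.lean`. (All exponents
`n/2 − p/2`, `p/2` are natural-number divisions/subtractions, `p ≤ n` inside the sums.)

References: S. David, N. Hirata-Kohno, M. Kawashima, Moscow J. Comb. Number Th. 9 (2020), Thm 2.1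
[DavidHirataKohnoKawashima2020]; E. M. Nikišin, Mat. Sb. 109 (1979); M. Hata, J. Math. Pures Appl. 69 (1990).
-/

noncomputable section

open Finset

namespace Literature.NumberTheory.DiophantineApproximation

namespace ParityPade

/-- The coefficient of `Li_{o+1}(a/b)` in `a^{n/2} 2^w Λ^{(w)}_n(a/b)` (odd pole indices):
`∑_{p ≤ n, p odd} c_{o,p} 2^{w−1−o} b^{p/2} a^{n/2 − p/2}`. [cite: DavidHirataKohnoKawashima2020, Thm 2.1] -/
def coefLiQ (n w : ℕ) (c : ℕ → ℕ → ℚ) (b a o : ℕ) : ℚ :=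
  ∑ p ∈ range (n + 1),
    if Odd p then c o p * 2 ^ (w - 1 - o) * (b : ℚ) ^ (p / 2) * (a : ℚ) ^ (n / 2 - p / 2) else 0

/-- The coefficient of `Θ_{o+1}(a/b)` in `a^{n/2} 2^w Λ^{(w)}_n(a/b)` (even pole indices):
`∑_{p ≤ n, p even} c_{o,p} 2^w b^{p/2} a^{n/2 − p/2}`. [cite: DavidHirataKohnoKawashima2020, Thm 2.1] -/
def coefThQ (n w : ℕ) (c : ℕ → ℕ → ℚ) (b a o : ℕ) : ℚ :=
  ∑ p ∈ range (n + 1),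
    if Even p then c o p * 2 ^ w * (b : ℚ) ^ (p / 2) * (a : ℚ) ^ (n / 2 - p / 2) else 0

/-- The constant term of `a^{n/2} 2^w Λ^{(w)}_n(a/b)` (the finite remainders of the two shift identities):
odd `p`: `2^{w−1−o} ∑_{k<p/2} b^{p/2} a^{n/2−p/2} · a^{k+1}/(b^{k+1}(k+1)^{o+1})`; even `p`:
`2^w ∑_{k<p/2} b^{p/2} a^{n/2−p/2} · a^{k+1}/(b^{k+1}(2k+1)^{o+1})`; summed against `−c_{o,p}`.
[cite: DavidHirataKohnoKawashima2020, Thm 2.1] -/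
def constHQ (n w : ℕ) (c : ℕ → ℕ → ℚ) (b a : ℕ) : ℚ :=
  -∑ o ∈ range w, ∑ p ∈ range (n + 1), c o p *
    (if Odd p then
      (2 : ℚ) ^ (w - 1 - o) *
        ∑ k ∈ range (p / 2), (b : ℚ) ^ (p / 2) * (a : ℚ) ^ (n / 2 - p / 2) *
          ((a : ℚ) ^ (k + 1) / ((b : ℚ) ^ (k + 1) * ((k : ℚ) + 1) ^ (o + 1)))
     else
      (2 : ℚ) ^ w *
        ∑ k ∈ range (p / 2), (b : ℚ) ^ (p / 2) * (a : ℚ) ^ (n / 2 - p / 2) *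
          ((a : ℚ) ^ (k + 1) / ((b : ℚ) ^ (k + 1) * (2 * (k : ℚ) + 1) ^ (o + 1))))

/-- At `a = 1` the rational-point `Li`-coefficient is `coefLi` (with `M = b`). [folklore] -/
theorem coefLiQ_one (n w : ℕ) (c : ℕ → ℕ → ℚ) (b o : ℕ) : coefLiQ n w c b 1 o = coefLi n w c b o := by
  unfold coefLiQ coefLi
  refine sum_congr rfl fun p _ => ?_
  split_ifs <;> simp

/-- At `a = 1` the rational-point `Θ`-coefficient is `coefTh` (with `M = b`). [folklore] -/
theorem coefThQ_one (n w : ℕ) (c : ℕ → ℕ → ℚ) (b o : ℕ) : coefThQ n w c b 1 o = coefTh n w c b o := by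
  unfold coefThQ coefTh
  refine sum_congr rfl fun p _ => ?_
  split_ifs <;> simp

/-- At `a = 1` the rational-point constant term is `constH` (with `M = b`). [folklore] -/
theorem constHQ_one (n w : ℕ) (c : ℕ → ℕ → ℚ) (b : ℕ) : constHQ n w c b 1 = constH n w c b := by
  unfold constHQ constH
  congr 1
  refine sum_congr rfl fun o _ => sum_congr rfl fun p _ => ?_
  congr 1
  split_ifs
  · congr 1
    refine sum_congr rfl fun k _ => ?_
    simp only [Nat.cast_one, one_pow, mul_one]
    ring
  · congr 1
    refine sum_congr rfl fun k _ => ?_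
    simp only [Nat.cast_one, one_pow, mul_one]
    ring

end ParityPade

end Literature.NumberTheory.DiophantineApproximation
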